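import Summits.Ventures.DiscreteObjects.Hadamard.AutomorphismTransfer668
import Summits.Ventures.DiscreteObjects.Hadamard.PrimeOrder17to47

/-!
# Hadamard 668 census, family F12 — H(668) has no automorphism of order 17, 19, 31, 47 either (kernel):
# 109 primes in all

Framing: lottery ticket; floor = certified bounds/negative ranges.

Cell pub-namedobj (venture DiscreteObjects), target (H), hadamard gen 6.  `AutomorphismTransfer668` turned a signed-permutation
automorphism of a Hadamard matrix of order `668` with a fixed row `r` and a fixed column `c` into an automorphism pair of the
`0/1` structure `inc H r c` on `{i ≠ r} × {j ≠ c}` (row sums `333`, distinct-row products `166`).  `PrimeOrder17to47` excludes the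
primes `17, 19, 31, 47` for such structures when ALSO the column sums are `333` and distinct-column products `166` and
`|P| = |B| = 667`.  This file supplies the column half from `Hᵀ H = 668·I` — via the transpose: `Hᵀ` is again a Hadamard matrix
(`isHadamard_transpose`) and `inc Hᵀ c r j i = inc H r c i j` (`inc_transpose`) — and concludes:
* `no_hadamard668_signedAut_17_19_31_47`: no Hadamard matrix of order `668` has a signed automorphism `(π, κ, d, e)` with
  `π^p = κ^p = 1`, `π ≠ 1 ∨ κ ≠ 1`, for `p ∈ {17, 19, 31, 47}`;
* `no_hadamard668_signedAut_primes109`: the same for all 109 primes `p ∈ {17, 19, 31, 47} ∪ ([43, 661] ∖ {47, 83, 167})`,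
  i.e. every odd prime `p ≤ 661` other than `3, 5, 7, 11, 13, 23, 29, 37, 41, 83, 167`.
Everything in the kernel from `IsHadamardMatrix`; the paper steps left in the census line for H(668) are Lander's parity theorem
for `p = 29` (fixed-point-free case) only.  Ours, not literature; no `sorry`.
-/

open Finset BigOperators Matrix

namespace Summit.Ventures.DiscreteObjects.Hadamard

open Literature.Combinatorics.Designs.GoethalsSeidel (IsHadamardMatrix)

variable {ι : Type*} [Fintype ι] [DecidableEq ι]

section dual
variable {H : Matrix ι ι ℤ} {r c : ι}

/-- the transpose of a Hadamard matrix is a Hadamard matrix (`Hᵀ H = n I` from `H Hᵀ = n I`) -/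
lemma isHadamard_transpose (hH : IsHadamardMatrix H) (hcard : (Fintype.card ι : ℤ) ≠ 0) : IsHadamardMatrix Hᵀ :=
  ⟨fun i j => hH.1 j i, by
    rw [Matrix.transpose_transpose]
    exact transpose_mul_self_of_mul_transpose H _ hcard hH.2⟩

omit [Fintype ι] [DecidableEq ι] in
/-- normalising commutes with transposition -/
lemma nrm_transpose (i j : ι) : nrm Hᵀ c r j i = nrm H r c i j := by
  unfold nrm
  simp only [Matrix.transpose_apply]
  ring

omit [Fintype ι] [DecidableEq ι] in
/-- the `+1` pattern commutes with transposition -/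
lemma inc_transpose (i j : ι) : inc Hᵀ c r j i = inc H r c i j := by
  unfold inc
  rw [nrm_transpose]

/-- **Column sums.** For a Hadamard matrix of order `668` and `j ≠ c`: `Σ_i inc i j = 334`. -/
lemma inc_colsum_full (hH : IsHadamardMatrix H) (hι : Fintype.card ι = 668) {j : ι} (h : j ≠ c) :
    ∑ i, inc H r c i j = 334 := by
  have hcard : (Fintype.card ι : ℤ) ≠ 0 := by rw [hι]; norm_num
  rw [Finset.sum_congr rfl fun i _ => (inc_transpose (H := H) (r := r) (c := c) i j).symm]
  exact inc_rowsum_full (isHadamard_transpose hH hcard) hι h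

/-- **Column inner products.** For distinct `j, j' ≠ c`: `Σ_i inc i j * inc i j' = 167`. -/
lemma inc_cpair_full (hH : IsHadamardMatrix H) (hι : Fintype.card ι = 668) {j j' : ι} (hj : j ≠ c) (hj' : j' ≠ c)
    (h : j ≠ j') : ∑ i, inc H r c i j * inc H r c i j' = 167 := by
  have hcard : (Fintype.card ι : ℤ) ≠ 0 := by rw [hι]; norm_num
  rw [Finset.sum_congr rfl fun i _ => by
    rw [← inc_transpose (H := H) (r := r) (c := c) i j, ← inc_transpose (H := H) (r := r) (c := c) i j']]
  exact inc_pair_full (isHadamard_transpose hH hcard) hι hj hj' h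

end dual

section transfer
variable {H : Matrix ι ι ℤ} {r c : ι}

/-- **Transfer with both halves (fixed row and column given).**  For `p ∈ {17, 19, 31, 47}` a Hadamard matrix of order `668`
has no signed automorphism with `π^p = κ^p = 1`, `π ≠ 1`, `π r = r`, `κ c = c`. -/
theorem no_hadamard668_signedAut_of_fixed' (hH : IsHadamardMatrix H) (hι : Fintype.card ι = 668)
    (p : ℕ) (hmem : p = 17 ∨ p = 19 ∨ p = 31 ∨ p = 47)
    (π κ : Equiv.Perm ι) (d e : ι → ℤ) (haut : IsSignedAut H π κ d e)
    (hπ : π ^ p = 1) (hκ : κ ^ p = 1) (hne : π ≠ 1) (hr : π r = r) (hc : κ c = c) : False := by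
  -- the incidence function on the subtypes
  let N : {i // i ≠ r} → {j // j ≠ c} → ℤ := fun x y => inc H r c x.1 y.1
  have h01 : ∀ x y, N x y = 0 ∨ N x y = 1 := fun x y => inc_01 x.1 y.1
  have hrow : ∀ x, ∑ y, N x y = 333 := by
    intro x
    show ∑ y : {j // j ≠ c}, inc H r c x.1 y.1 = 333
    rw [sum_subtype_ne (fun j => inc H r c x.1 j) c, inc_rowsum_full hH hι x.2, inc_col hH]
    norm_num
  have hpair : ∀ x x', x ≠ x' → ∑ y, N x y * N x' y = 166 := by
    intro x x' hxx'
    have hne' : x.1 ≠ x'.1 := fun h => hxx' (Subtype.ext h)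
    show ∑ y : {j // j ≠ c}, inc H r c x.1 y.1 * inc H r c x'.1 y.1 = 166
    rw [sum_subtype_ne (fun j => inc H r c x.1 j * inc H r c x'.1 j) c, inc_pair_full hH hι x.2 x'.2 hne',
      inc_col hH, inc_col hH]
    norm_num
  have hcol : ∀ y, ∑ x, N x y = 333 := by
    intro y
    show ∑ x : {i // i ≠ r}, inc H r c x.1 y.1 = 333
    rw [sum_subtype_ne (fun i => inc H r c i y.1) r, inc_colsum_full hH hι y.2]
    have : inc H r c r y.1 = 1 := by unfold inc; rw [if_pos (nrm_row hH y.1)]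
    rw [this]; norm_num
  have hcpair : ∀ y y', y ≠ y' → ∑ x, N x y * N x y' = 166 := by
    intro y y' hyy'
    have hne' : y.1 ≠ y'.1 := fun h => hyy' (Subtype.ext h)
    show ∑ x : {i // i ≠ r}, inc H r c x.1 y.1 * inc H r c x.1 y'.1 = 166
    rw [sum_subtype_ne (fun i => inc H r c i y.1 * inc H r c i y'.1) r, inc_cpair_full hH hι y.2 y'.2 hne']
    have e1 : inc H r c r y.1 = 1 := by unfold inc; rw [if_pos (nrm_row hH y.1)]
    have e2 : inc H r c r y'.1 = 1 := by unfold inc; rw [if_pos (nrm_row hH y'.1)]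
    rw [e1, e2]; norm_num
  have hP : Fintype.card {i // i ≠ r} = 667 := by rw [card_subtype_ne', hι]
  have hB : Fintype.card {j // j ≠ c} = 667 := by rw [card_subtype_ne', hι]
  -- the induced permutations
  have hπr : ∀ i, π i ≠ r ↔ i ≠ r := by
    intro i
    constructor
    · intro h hi; exact h (by rw [hi, hr])
    · intro h hi; exact h (π.injective (by rw [hi, hr]))
  have hκc : ∀ j, κ j ≠ c ↔ j ≠ c := by
    intro j
    constructor
    · intro h hj; exact h (by rw [hj, hc])
    · intro h hj; exact h (κ.injective (by rw [hj, hc]))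
  let ρ : Equiv.Perm {i // i ≠ r} := π.subtypePerm hπr
  let τ : Equiv.Perm {j // j ≠ c} := κ.subtypePerm hκc
  have hN : ∀ x y, N (ρ x) (τ y) = N x y := by
    intro x y
    show inc H r c (π x.1) (κ y.1) = inc H r c x.1 y.1
    exact inc_aut haut hr hc x.1 y.1
  have hρ : ρ ^ p = 1 := by
    ext x
    simp [ρ, Equiv.Perm.subtypePerm_pow, hπ]
  have hτ : τ ^ p = 1 := by
    ext y
    simp [τ, Equiv.Perm.subtypePerm_pow, hκ]
  -- a moved point
  obtain ⟨i₀, hi₀⟩ : ∃ i, π i ≠ i := by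
    by_contra h
    exact hne (Equiv.ext fun i => not_not.mp (not_exists.mp h i))
  have hi₀r : i₀ ≠ r := fun h => hi₀ (by rw [h, hr])
  have hx₀ : ρ ⟨i₀, hi₀r⟩ ≠ ⟨i₀, hi₀r⟩ := by
    intro h
    apply hi₀
    have := congrArg Subtype.val h
    simpa [ρ] using this
  exact no_automorphism_17_19_31_47 N h01 hrow hpair hcol hcpair hP hB p hmem ρ τ hN hρ hτ ⟨i₀, hi₀r⟩ hx₀

/-- **No Hadamard matrix of order 668 has a nontrivial signed automorphism `(π, κ, d, e)` with `π^p = κ^p = 1` for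
`p ∈ {17, 19, 31, 47}`.** -/
theorem no_hadamard668_signedAut_17_19_31_47 (hH : IsHadamardMatrix H) (hι : Fintype.card ι = 668)
    (p : ℕ) (hmem : p = 17 ∨ p = 19 ∨ p = 31 ∨ p = 47)
    (π κ : Equiv.Perm ι) (d e : ι → ℤ) (haut : IsSignedAut H π κ d e)
    (hπ : π ^ p = 1) (hκ : κ ^ p = 1) (hne : π ≠ 1 ∨ κ ≠ 1) : False := by
  have hcard : (Fintype.card ι : ℤ) ≠ 0 := by rw [hι]; norm_num
  have hp : p.Prime := by rcases hmem with rfl | rfl | rfl | rfl <;> norm_num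
  have hodd : Odd p := by rcases hmem with rfl | rfl | rfl | rfl <;> decide
  have hnd : ¬ p ∣ Fintype.card ι := by rw [hι]; rcases hmem with rfl | rfl | rfl | rfl <;> norm_num
  have hπ1 : π ≠ 1 := by
    rcases hne with h | h
    · exact h
    · intro hπ1
      apply h
      rw [hπ1] at haut
      exact signedAut_snd_eq_one H hH hcard haut hodd hκ
  haveI : Fact p.Prime := ⟨hp⟩
  obtain ⟨r, hr⟩ := Equiv.Perm.exists_fixed_point_of_prime (n := 1) hnd (σ := π) (by rw [pow_one]; exact hπ)
  obtain ⟨c, hc⟩ := Equiv.Perm.exists_fixed_point_of_prime (n := 1) hnd (σ := κ) (by rw [pow_one]; exact hκ)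
  exact no_hadamard668_signedAut_of_fixed' hH hι p hmem π κ d e haut hπ hκ hπ1 hr hc

/-- **109 primes.** No Hadamard matrix of order `668` has a nontrivial signed automorphism `(π, κ, d, e)` with `π^p = κ^p = 1`
for any prime `p` that is one of `17, 19, 31, 47` or lies in `[43, 661] ∖ {47, 83, 167}` — every odd prime `p ≤ 661` except
`3, 5, 7, 11, 13, 23, 29, 37, 41, 83, 167`. -/
theorem no_hadamard668_signedAut_primes109 (hH : IsHadamardMatrix H) (hι : Fintype.card ι = 668)
    (p : ℕ) (hp : p.Prime) (hmem : p ∈ primes106 ∨ p = 17 ∨ p = 19 ∨ p = 31 ∨ p = 47) (h167 : p ≠ 167)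
    (π κ : Equiv.Perm ι) (d e : ι → ℤ) (haut : IsSignedAut H π κ d e)
    (hπ : π ^ p = 1) (hκ : κ ^ p = 1) (hne : π ≠ 1 ∨ κ ≠ 1) : False := by
  rcases hmem with h | h
  · exact no_hadamard668_signedAut_primes105 hH hι p hp h h167 π κ d e haut hπ hκ hne
  · exact no_hadamard668_signedAut_17_19_31_47 hH hι p h π κ d e haut hπ hκ hne

end transfer

end Summit.Ventures.DiscreteObjects.Hadamard
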